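import Literature.NumberTheory.Automorphic.FuchsianInvariantHeight
import Literature.NumberTheory.Automorphic.FundamentalDomainCosetUnfolding
import Literature.NumberTheory.Automorphic.ShimuraCurveDataExistence
import HarnessLib

/-!
# Cusp frames of a finite-index subgroup of `SL₂(ℤ)`: scaling matrices, cusp sectors and the
# invariant height (Shimura §1.3–1.5; Iwaniec §2.2, §2.6)

Layer `Literature/NumberTheory/ModularForms`, namespace `Literature.NumberTheory.ModularForms.ModularCurve`.
First brick of the construction of the compact Riemann surface `X(Γ) = Γ∖ℍ ∪ {cusps}` of a finite-index
subgroup `Γ ≤ SL₂(ℤ)` (G. Shimura, *Introduction to the arithmetic theory of automorphic functions* (1971),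
§1.3–§1.5; F. Diamond, J. Shurman, *A first course in modular forms*, GTM 228, §2.4). This file only SPECIALISES
the tree's theory of general finite-covolume Fuchsian groups (`Literature/NumberTheory/Automorphic/Fuchsian*.lean`,
after H. Iwaniec, *Spectral methods of automorphic forms*, §2) to the group `Γ± = Γ·{±1} ≤ GL₂(ℝ)` and fixes,
once and for all, a complete system of cusp frames by choice:

* §1 the side conditions of the Fuchsian files for `Γ± = (↑Γ).adjoinNegOne` (`≤ SL₂(ℝ)`, `∋ -1`, discrete,
  a measurable fundamental domain of FINITE hyperbolic area — the last by the tree's coset unfolding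
  `setLIntegral_eq_setLIntegral_fd_sum_cosets` against Mathlib's `ModularGroup.fd`);
* §2 the chosen data (`numCusps`, `cusp`, `frame`, `core`): inequivalent cusps `𝔞_i = σ_i ∞` exhausting
  the cusps of `Γ`, scaling matrices `σ_i ∈ SL₂(ℝ)` with `σ_i⁻¹ Γ± σ_i` of period `1`, and a compact core `K`
  such that every point of `ℍ` is `Γ`-equivalent to a point of `K` or of a cusp sector `σ_i{Im > 1}`
  (`core_cover`); `numCusps_pos`;
* §3 THE SECTOR LEMMA `frame_smul_eq_smul_frame_smul_iff`: for `Im w, Im w' > 1`, `σ_j w' ∈ Γ σ_i w` iff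
  `i = j` and `w' = w + n`, `n ∈ ℤ` (Shimizu separation of the horoballs of a complete cusp system);
* the invariant height of this frame (with its CONTINUITY) is the sequel `ModularCurveInvariantHeight.lean`.

Everything is proved; the four definitions are choices (`Classical.choose`) with their specification
theorems; no named facts, no instances.

## References

* G. Shimura, *Introduction to the arithmetic theory of automorphic functions*, Publ. Math. Soc. Japan 11
  (1971), §1.3 (cusps, Prop. 1.17), §1.5 (the quotient `Γ∖ℍ*`, Thm. 1.28, Prop. 1.29–1.30). [ShimuraIATAF1971]
* H. Iwaniec, *Spectral methods of automorphic forms*, 2nd ed., GSM 53 (2002), §2.2 (2.1)–(2.5), §2.6 (2.42).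
  [Iwaniec2002]
* F. Diamond, J. Shurman, *A first course in modular forms*, GTM 228 (2005), §2.4. [DiamondShurman2005]
-/

noncomputable section

open scoped MatrixGroups Pointwise Topology ENNReal
open Set Filter Function UpperHalfPlane
open Literature.NumberTheory.Automorphic Literature.NumberTheory.Automorphic.Fuchsian

namespace Literature.NumberTheory.ModularForms

namespace ModularCurve

variable (Γ : Subgroup SL(2, ℤ))

/-! ### §1 The group `Γ± = Γ·{±1} ≤ GL₂(ℝ)` and the side conditions of the Fuchsian theory -/

/-- `Γ± = (↑Γ)·{±1}` as a subgroup of `GL₂(ℝ)` (Mathlib's `adjoinNegOne` of the image of `Γ`). It has the same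
orbits on `ℍ` and the same cusps as `Γ`, and contains `-1`, as the tree's Fuchsian files require. [folklore] -/
abbrev pm : Subgroup (GL (Fin 2) ℝ) := (Γ : Subgroup (GL (Fin 2) ℝ)).adjoinNegOne

/-- `Γ ≤ Γ±`. [cite: Iwaniec2002, §2.1] -/
theorem le_pm : (Γ : Subgroup (GL (Fin 2) ℝ)) ≤ pm Γ := Subgroup.le_adjoinNegOne _

/-- `-1 ∈ Γ±`. [cite: Iwaniec2002, §2.1] -/
theorem neg_one_mem_pm : (-1 : GL (Fin 2) ℝ) ∈ pm Γ := Subgroup.negOne_mem_adjoinNegOne _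

/-- The image of `Γ` lies in the image `𝒮ℒ` of `SL₂(ℤ)`. [cite: ShimuraIATAF1971, §1.5] -/
theorem coe_le_modular : (Γ : Subgroup (GL (Fin 2) ℝ)) ≤ 𝒮ℒ := by
  rintro _ ⟨g, -, rfl⟩
  exact ⟨g, rfl⟩

/-- `Γ± ≤ 𝒮ℒ` (as `-1 ∈ 𝒮ℒ`). [cite: ShimuraIATAF1971, §1.5] -/
theorem pm_le_modular : pm Γ ≤ 𝒮ℒ := by
  intro g hg
  rcases (Subgroup.mem_adjoinNegOne_iff.mp hg) with h | h
  · exact coe_le_modular Γ h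
  · have := Subgroup.mul_mem _ neg_one_mem_modular (coe_le_modular Γ h)
    simpa using this

/-- `Γ± ≤ SL₂(ℝ)` inside `GL₂(ℝ)`. [cite: Iwaniec2002, §2.1] -/
theorem pm_le_range_toGL : pm Γ ≤ (Matrix.SpecialLinearGroup.toGL : SL(2, ℝ) →* GL (Fin 2) ℝ).range :=
  (pm_le_modular Γ).trans modular_le_range_toGL

/-- The image of `Γ` lies in `SL₂(ℝ)`. [cite: Iwaniec2002, §2.1] -/
theorem coe_le_range_toGL :
    (Γ : Subgroup (GL (Fin 2) ℝ)) ≤ (Matrix.SpecialLinearGroup.toGL : SL(2, ℝ) →* GL (Fin 2) ℝ).range :=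
  (le_pm Γ).trans (pm_le_range_toGL Γ)

/-- `Γ±` is discrete in Iwaniec's norm-ball sense (a subgroup of the discrete `𝒮ℒ`). [cite: Iwaniec2002, §2.1] -/
theorem isDiscreteSubgroup_pm : IsDiscreteSubgroup (pm Γ) := fun r =>
  (isDiscreteSubgroup_modular r).subset fun _ hγ => ⟨pm_le_modular Γ hγ.1, hγ.2⟩

/-- An element of `Γ±` is `±` an element of `Γ`; in particular it ACTS ON `ℍ` as an element of `Γ` (`-1` acts
trivially on `ℍ`). [cite: ShimuraIATAF1971, §1.5] -/
theorem exists_mem_coe_smul_eq_of_mem_pm {g : GL (Fin 2) ℝ} (hg : g ∈ pm Γ) :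
    ∃ γ ∈ (Γ : Subgroup (GL (Fin 2) ℝ)), ∀ z : ℍ, γ • z = g • z := by
  rcases (Subgroup.mem_adjoinNegOne_iff.mp hg) with h | h
  · exact ⟨g, h, fun z => rfl⟩
  · exact ⟨-g, h, fun z => UpperHalfPlane.neg_smul g z⟩

/-- `(-g) • c = g • c` on `ℙ¹(ℝ)` (scalar matrices act trivially by Möbius transformations). [cite: ShimuraIATAF1971, §1.1] -/
theorem neg_smul_onePoint (g : GL (Fin 2) ℝ) (c : OnePoint ℝ) : (-g) • c = g • c := by
  have key : ∀ x : OnePoint ℝ, (-g) • x = g • x := by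
    intro x
    induction x using OnePoint.rec with
    | infty =>
      rw [OnePoint.smul_infty_eq_ite, OnePoint.smul_infty_eq_ite]
      simp only [Units.val_neg, Matrix.neg_apply, neg_eq_zero]
      split_ifs <;> simp [neg_div_neg_eq]
    | coe t =>
      rw [OnePoint.smul_some_eq_ite, OnePoint.smul_some_eq_ite]
      simp only [Units.val_neg, Matrix.neg_apply]
      have e1 : -(g : Matrix (Fin 2) (Fin 2) ℝ) 1 0 * t + -(g : Matrix (Fin 2) (Fin 2) ℝ) 1 1 =
          -((g : Matrix (Fin 2) (Fin 2) ℝ) 1 0 * t + (g : Matrix (Fin 2) (Fin 2) ℝ) 1 1) := by ring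
      have e2 : -(g : Matrix (Fin 2) (Fin 2) ℝ) 0 0 * t + -(g : Matrix (Fin 2) (Fin 2) ℝ) 0 1 =
          -((g : Matrix (Fin 2) (Fin 2) ℝ) 0 0 * t + (g : Matrix (Fin 2) (Fin 2) ℝ) 0 1) := by ring
      by_cases h0 : (g : Matrix (Fin 2) (Fin 2) ℝ) 1 0 * t + (g : Matrix (Fin 2) (Fin 2) ℝ) 1 1 = 0
      · have h0' : -(g : Matrix (Fin 2) (Fin 2) ℝ) 1 0 * t + -(g : Matrix (Fin 2) (Fin 2) ℝ) 1 1 = 0 := by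
          rw [e1, h0, neg_zero]
        rw [if_pos h0', if_pos h0]
      · have h0' : ¬ (-(g : Matrix (Fin 2) (Fin 2) ℝ) 1 0 * t + -(g : Matrix (Fin 2) (Fin 2) ℝ) 1 1 = 0) := by
          rw [e1, neg_eq_zero]; exact h0
        rw [if_neg h0', if_neg h0, e1, e2, neg_div_neg_eq]
  exact key c

/-- An element of `Γ±` acts on `ℙ¹(ℝ)` as an element of `Γ`. [cite: ShimuraIATAF1971, §1.3] -/
theorem exists_mem_coe_smul_onePoint_eq_of_mem_pm {g : GL (Fin 2) ℝ} (hg : g ∈ pm Γ) :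
    ∃ γ ∈ (Γ : Subgroup (GL (Fin 2) ℝ)), ∀ c : OnePoint ℝ, γ • c = g • c := by
  rcases (Subgroup.mem_adjoinNegOne_iff.mp hg) with h | h
  · exact ⟨g, h, fun c => rfl⟩
  · exact ⟨-g, h, fun c => neg_smul_onePoint g c⟩

/-- The cusps of `Γ±` are the cusps of `Γ` (Mathlib: commensurable groups have the same cusps). [cite: ShimuraIATAF1971, §1.3] -/
theorem isCusp_pm_iff {c : OnePoint ℝ} : IsCusp c (pm Γ) ↔ IsCusp c (Γ : Subgroup (GL (Fin 2) ℝ)) :=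
  (Subgroup.commensurable_adjoinNegOne_self (Γ : Subgroup (GL (Fin 2) ℝ))).isCusp_iff (c := c)

/-- The pull-back of `Γ±` to `SL₂(ℤ)`: the subgroup `{g : g ∈ Γ ∨ -g ∈ Γ}`. [folklore] -/
private abbrev pmZ : Subgroup SL(2, ℤ) := (pm Γ).comap (Matrix.SpecialLinearGroup.mapGL ℝ)

/-- `Γ ≤ Γ±` inside `SL₂(ℤ)`. [folklore] -/
private theorem le_pmZ : Γ ≤ pmZ Γ := fun g hg => le_pm Γ ⟨g, hg, rfl⟩

/-- `-1 ∈ Γ±` inside `SL₂(ℤ)`. [folklore] -/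
private theorem neg_one_mem_pmZ : (-1 : SL(2, ℤ)) ∈ pmZ Γ := by
  change Matrix.SpecialLinearGroup.mapGL ℝ (-1 : SL(2, ℤ)) ∈ pm Γ
  have e : Matrix.SpecialLinearGroup.mapGL ℝ (-1 : SL(2, ℤ)) = (-1 : GL (Fin 2) ℝ) := by
    ext i j
    fin_cases i <;> fin_cases j <;> simp [Matrix.SpecialLinearGroup.mapGL, Matrix.SpecialLinearGroup.toGL]
  rw [e]
  exact neg_one_mem_pm Γ

/-- The image of the pull-back is `Γ±` again (`Γ± ≤ 𝒮ℒ`). [folklore] -/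
private theorem map_pmZ : (pmZ Γ : Subgroup (GL (Fin 2) ℝ)) = pm Γ := by
  refine le_antisymm (Subgroup.map_comap_le _ _) fun g hg => ?_
  obtain ⟨g₀, rfl⟩ := pm_le_modular Γ hg
  exact ⟨g₀, hg, rfl⟩

/-- **`Γ±` has a measurable fundamental domain of finite hyperbolic area** when `Γ` has finite index in
`SL₂(ℤ)`: any fundamental domain (the tree's lexicographic Dirichlet set) has area `[SL₂(ℤ) : Γ±]·|𝒟| < ∞` by
coset unfolding against the modular domain. [cite: Iwaniec2002, §2.4 Prop. 2.4] -/
theorem exists_isHypFundamentalDomain_pm [Γ.FiniteIndex] :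
    ∃ F : Set ℍ, IsHypFundamentalDomain (pm Γ) F ∧ MeasureTheory.volume F < ⊤ := by
  classical
  obtain ⟨F, hF⟩ := exists_isHypFundamentalDomain_of_isDiscreteSubgroup (pm_le_range_toGL Γ) (isDiscreteSubgroup_pm Γ)
  refine ⟨F, hF, ?_⟩
  haveI : (pmZ Γ).FiniteIndex := Subgroup.finiteIndex_of_le (le_pmZ Γ)
  haveI : Fintype (SL(2, ℤ) ⧸ pmZ Γ) := Fintype.ofFinite _
  have hF' : IsHypFundamentalDomain ((pmZ Γ).map (Matrix.SpecialLinearGroup.mapGL ℝ)) F := by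
    have e : (pmZ Γ).map (Matrix.SpecialLinearGroup.mapGL ℝ) = pm Γ := map_pmZ Γ
    rw [e]; exact hF
  have key := setLIntegral_eq_setLIntegral_fd_sum_cosets (Γ' := pmZ Γ) (neg_one_mem_pmZ Γ) hF'
    (ψ := fun _ => (1 : ℝ≥0∞)) measurable_const (fun _ _ _ => rfl)
  rw [MeasureTheory.setLIntegral_one] at key
  rw [key]
  simp only [Finset.sum_const, Finset.card_univ, nsmul_eq_mul, mul_one]
  rw [MeasureTheory.setLIntegral_const]
  exact ENNReal.mul_lt_top (by simp) volume_modular_fd_lt_top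

/-! ### §2 The chosen system of cusp frames and the compact core -/

section Frames

variable [Γ.FiniteIndex]

/-- **Existence of a complete system of cusp frames with a compact core** for `Γ±` (the tree's
`Fuchsian.exists_cuspSystem_and_compact_core`, Iwaniec Prop. 2.3–2.5 with (2.1)–(2.5)). [cite: Iwaniec2002, §2.2 (2.1)–(2.5)] -/
theorem exists_frames : ∃ (h : ℕ) (𝔞 : Fin h → OnePoint ℝ) (σ : Fin h → SL(2, ℝ)) (K : Set ℍ),
    (∀ i, (Matrix.SpecialLinearGroup.toGL (σ i) : GL (Fin 2) ℝ) • (OnePoint.infty : OnePoint ℝ) = 𝔞 i) ∧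
    (∀ i, (ConjAct.toConjAct (Matrix.SpecialLinearGroup.toGL (σ i) : GL (Fin 2) ℝ)⁻¹ • pm Γ).strictPeriods =
      AddSubgroup.zmultiples 1) ∧
    (∀ i j, ∀ γ ∈ pm Γ, γ • 𝔞 i = 𝔞 j → i = j) ∧
    (∀ c : OnePoint ℝ, IsCusp c (pm Γ) → ∃ i, ∃ γ ∈ pm Γ, γ • 𝔞 i = c) ∧
    IsCompact K ∧
    ∀ z : ℍ, ∃ γ ∈ pm Γ, γ • z ∈ K ∨
      ∃ i, γ • z ∈ (Matrix.SpecialLinearGroup.toGL (σ i) : GL (Fin 2) ℝ) • {w : ℍ | 1 < w.im} := by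
  obtain ⟨F, hF, hvol⟩ := exists_isHypFundamentalDomain_pm Γ
  obtain ⟨h, 𝔞, σ, K, -, hinfty, hper, hineq, hcomplete, hK, hcover⟩ :=
    exists_cuspSystem_and_compact_core (pm_le_range_toGL Γ) (neg_one_mem_pm Γ) (isDiscreteSubgroup_pm Γ) hF hvol
  exact ⟨h, 𝔞, σ, K, hinfty, hper, hineq, hcomplete, hK, hcover⟩

/-- **The number of cusps** `h` of `Γ` (the size of the chosen complete system of inequivalent cusps).
[cite: ShimuraIATAF1971, §1.5 Prop. 1.29] -/
def numCusps : ℕ := (exists_frames Γ).choose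

/-- **The chosen inequivalent cusps** `𝔞_i ∈ ℙ¹(ℝ)`, `i < h`. [cite: ShimuraIATAF1971, §1.3 and §1.5] -/
def cusp : Fin (numCusps Γ) → OnePoint ℝ := (exists_frames Γ).choose_spec.choose

/-- **The chosen scaling matrices (cusp frames)** `σ_i ∈ SL₂(ℝ)`: `σ_i ∞ = 𝔞_i` and `σ_i⁻¹ Γ± σ_i` has
periods `ℤ` (Iwaniec (2.1)). [cite: Iwaniec2002, §2.2 (2.1)] -/
def frame : Fin (numCusps Γ) → SL(2, ℝ) := (exists_frames Γ).choose_spec.choose_spec.choose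

/-- **The chosen compact core** `K ⊆ ℍ` (Iwaniec (2.5)). [cite: Iwaniec2002, §2.2 (2.5)] -/
def core : Set ℍ := (exists_frames Γ).choose_spec.choose_spec.choose_spec.choose

/-- The frame `σ_i` as an element of `GL₂(ℝ)` (plumbing abbreviation). [folklore] -/
abbrev frameGL (i : Fin (numCusps Γ)) : GL (Fin 2) ℝ := Matrix.SpecialLinearGroup.toGL (frame Γ i)

/-- The specification of the chosen data. [folklore] -/
private theorem frames_spec :
    (∀ i, frameGL Γ i • (OnePoint.infty : OnePoint ℝ) = cusp Γ i) ∧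
    (∀ i, (ConjAct.toConjAct (frameGL Γ i)⁻¹ • pm Γ).strictPeriods = AddSubgroup.zmultiples 1) ∧
    (∀ i j, ∀ γ ∈ pm Γ, γ • cusp Γ i = cusp Γ j → i = j) ∧
    (∀ c : OnePoint ℝ, IsCusp c (pm Γ) → ∃ i, ∃ γ ∈ pm Γ, γ • cusp Γ i = c) ∧
    IsCompact (core Γ) ∧
    ∀ z : ℍ, ∃ γ ∈ pm Γ, γ • z ∈ core Γ ∨ ∃ i, γ • z ∈ frameGL Γ i • {w : ℍ | 1 < w.im} :=
  (exists_frames Γ).choose_spec.choose_spec.choose_spec.choose_spec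

/-- `σ_i ∞ = 𝔞_i`. [cite: Iwaniec2002, §2.2 (2.1)] -/
theorem frameGL_smul_infty (i : Fin (numCusps Γ)) : frameGL Γ i • (OnePoint.infty : OnePoint ℝ) = cusp Γ i :=
  (frames_spec Γ).1 i

/-- `σ_i⁻¹ Γ± σ_i` has strict periods `ℤ`. [cite: Iwaniec2002, §2.2 (2.1)] -/
theorem strictPeriods_frame (i : Fin (numCusps Γ)) :
    (ConjAct.toConjAct (frameGL Γ i)⁻¹ • pm Γ).strictPeriods = AddSubgroup.zmultiples 1 :=
  (frames_spec Γ).2.1 i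

/-- The chosen cusps are pairwise `Γ±`-inequivalent. [cite: ShimuraIATAF1971, §1.5] -/
theorem cusp_inequivalent_pm {i j : Fin (numCusps Γ)} {γ : GL (Fin 2) ℝ} (hγ : γ ∈ pm Γ)
    (h : γ • cusp Γ i = cusp Γ j) : i = j :=
  (frames_spec Γ).2.2.1 i j γ hγ h

/-- The chosen cusps are pairwise `Γ`-inequivalent. [cite: ShimuraIATAF1971, §1.5] -/
theorem cusp_inequivalent {i j : Fin (numCusps Γ)} {γ : GL (Fin 2) ℝ} (hγ : γ ∈ (Γ : Subgroup (GL (Fin 2) ℝ)))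
    (h : γ • cusp Γ i = cusp Γ j) : i = j :=
  cusp_inequivalent_pm Γ (le_pm Γ hγ) h

/-- Every cusp of `Γ±` is `Γ±`-equivalent to a chosen one (the form the Fuchsian files consume).
[cite: ShimuraIATAF1971, §1.5 Prop. 1.29] -/
theorem cusp_complete_pm : ∀ c : OnePoint ℝ, IsCusp c (pm Γ) → ∃ i, ∃ γ ∈ pm Γ, γ • cusp Γ i = c :=
  (frames_spec Γ).2.2.2.1

/-- The chosen cusps are pairwise `Γ±`-inequivalent (the form the Fuchsian files consume). [cite: ShimuraIATAF1971, §1.5] -/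
theorem cusp_inequivalent_pm' : ∀ i j, ∀ γ ∈ pm Γ, γ • cusp Γ i = cusp Γ j → i = j :=
  (frames_spec Γ).2.2.1

/-- Every cusp of `Γ` is `Γ`-equivalent to a chosen one. [cite: ShimuraIATAF1971, §1.5 Prop. 1.29] -/
theorem exists_smul_cusp_eq {c : OnePoint ℝ} (hc : IsCusp c (Γ : Subgroup (GL (Fin 2) ℝ))) :
    ∃ i, ∃ γ ∈ (Γ : Subgroup (GL (Fin 2) ℝ)), γ • cusp Γ i = c := by
  obtain ⟨i, γ, hγ, h⟩ := (frames_spec Γ).2.2.2.1 c ((isCusp_pm_iff Γ).mpr hc)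
  obtain ⟨γ', hγ', e⟩ := exists_mem_coe_smul_onePoint_eq_of_mem_pm Γ hγ
  exact ⟨i, γ', hγ', by rw [e, h]⟩

/-- The chosen cusps are cusps of `Γ`. [cite: ShimuraIATAF1971, §1.3] -/
theorem isCusp_cusp (i : Fin (numCusps Γ)) : IsCusp (cusp Γ i) (Γ : Subgroup (GL (Fin 2) ℝ)) := by
  rw [← isCusp_pm_iff]
  -- `σ_i T σ_i⁻¹ ∈ Γ±` is parabolic and fixes `𝔞_i`
  have hT : Matrix.GeneralLinearGroup.upperRightHom (1 : ℝ) ∈ ConjAct.toConjAct (frameGL Γ i)⁻¹ • pm Γ := by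
    rw [← Subgroup.mem_strictPeriods_iff, strictPeriods_frame]
    exact AddSubgroup.mem_zmultiples 1
  rw [mem_conj_inv_iff] at hT
  refine ⟨_, hT, ?_, ?_⟩
  · rw [Matrix.GeneralLinearGroup.isParabolic_conj_iff]
    exact (Matrix.GeneralLinearGroup.isParabolic_iff_of_upperTriangular (by simp)).mpr ⟨by simp, by simp⟩
  · rw [mul_smul, mul_smul, ← frameGL_smul_infty, inv_smul_smul, smul_left_cancel_iff,
      OnePoint.smul_infty_eq_self_iff]
    simp

/-- The compact core is compact. [cite: Iwaniec2002, §2.2 (2.5)] -/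
theorem isCompact_core : IsCompact (core Γ) := (frames_spec Γ).2.2.2.2.1

/-- **Every point of `ℍ` is `Γ`-equivalent to a point of the compact core or of a cusp sector `σ_i{Im > 1}`.**
[cite: Iwaniec2002, §2.2 (2.5) and Prop. 2.3] -/
theorem core_cover (z : ℍ) : ∃ γ ∈ (Γ : Subgroup (GL (Fin 2) ℝ)),
    γ • z ∈ core Γ ∨ ∃ i, ∃ w : ℍ, 1 < w.im ∧ γ • z = frameGL Γ i • w := by
  obtain ⟨γ, hγ, h⟩ := (frames_spec Γ).2.2.2.2.2 z
  obtain ⟨γ', hγ', e⟩ := exists_mem_coe_smul_eq_of_mem_pm Γ hγ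
  refine ⟨γ', hγ', ?_⟩
  rw [e]
  rcases h with h | ⟨i, w, hw, hwz⟩
  · exact Or.inl h
  · exact Or.inr ⟨i, w, hw, hwz.symm⟩

/-- `∞` is a cusp of `Γ` (`Γ` has finite index in `SL₂(ℤ)`). [cite: ShimuraIATAF1971, §1.5] -/
theorem isCusp_infty : IsCusp (OnePoint.infty : OnePoint ℝ) (Γ : Subgroup (GL (Fin 2) ℝ)) := by
  rw [Subgroup.IsArithmetic.isCusp_iff_isCusp_SL2Z, isCusp_SL2Z_iff]
  exact ⟨OnePoint.infty, by simp⟩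

/-- There is at least one cusp: `0 < h`. [cite: ShimuraIATAF1971, §1.5] -/
theorem numCusps_pos : 0 < numCusps Γ := by
  obtain ⟨i, -⟩ := exists_smul_cusp_eq Γ (isCusp_infty Γ)
  exact Fin.pos i

/-- The cusp index type is non-empty. [cite: ShimuraIATAF1971, §1.5] -/
theorem nonempty_fin_numCusps : Nonempty (Fin (numCusps Γ)) := ⟨⟨0, numCusps_pos Γ⟩⟩

end Frames

/-! ### §3 The sector lemma: the horoballs `σ_i{Im > 1}` modulo `Γ` -/

section Sector

variable [Γ.FiniteIndex]

omit [Γ.FiniteIndex] in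
/-- An element of `Γ` is `toGL g` for some `g ∈ SL₂(ℝ)`. [folklore] -/
private theorem exists_toGL_eq_of_mem {γ : GL (Fin 2) ℝ} (hγ : γ ∈ (Γ : Subgroup (GL (Fin 2) ℝ))) :
    ∃ g : SL(2, ℝ), (Matrix.SpecialLinearGroup.toGL g : GL (Fin 2) ℝ) = γ :=
  coe_le_range_toGL Γ hγ

/-- **Integer translations in a frame are realised by `Γ`**: for every `n ∈ ℤ` there is `γ ∈ Γ` with
`γ σ_i w = σ_i (w + n)` for all `w` (`σ_i⁻¹ Γ± σ_i ∋ Tⁿ`). [cite: Iwaniec2002, §2.2 (2.1)] -/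
theorem exists_mem_smul_frame_eq_vadd (i : Fin (numCusps Γ)) (n : ℤ) :
    ∃ γ ∈ (Γ : Subgroup (GL (Fin 2) ℝ)), ∀ w : ℍ, γ • frameGL Γ i • w = frameGL Γ i • ((n : ℝ) +ᵥ w) := by
  have hT : Matrix.GeneralLinearGroup.upperRightHom (n : ℝ) ∈ ConjAct.toConjAct (frameGL Γ i)⁻¹ • pm Γ := by
    rw [← Subgroup.mem_strictPeriods_iff, strictPeriods_frame, AddSubgroup.mem_zmultiples_iff]
    exact ⟨n, by simp⟩
  rw [mem_conj_inv_iff] at hT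
  obtain ⟨γ, hγ, e⟩ := exists_mem_coe_smul_eq_of_mem_pm Γ hT
  refine ⟨γ, hγ, fun w => ?_⟩
  rw [e, mul_smul, mul_smul, inv_smul_smul, upperRightHom_smul]

/-- **THE SECTOR LEMMA.** For `Im w, Im w' > 1`: `σ_j w'` lies in the `Γ`-orbit of `σ_i w` iff `i = j` and
`w' = w + n` for some `n ∈ ℤ` (Shimizu's lemma separates the horoballs `σ_i{Im > 1}` of a complete system of
inequivalent cusps; inside one horoball only the cusp stabiliser `σ_i{±Tⁿ}σ_i⁻¹` acts).
[cite: Iwaniec2002, §2.2 (2.3)–(2.5) and §2.6 (2.30)] [cite: ShimuraIATAF1971, §1.5 Thm. 1.28 (proof)] -/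
theorem exists_mem_smul_frame_smul_eq_iff {i j : Fin (numCusps Γ)} {w w' : ℍ} (hw : 1 < w.im) (hw' : 1 < w'.im) :
    (∃ γ ∈ (Γ : Subgroup (GL (Fin 2) ℝ)), γ • frameGL Γ i • w = frameGL Γ j • w') ↔
      i = j ∧ ∃ n : ℤ, w' = (n : ℝ) +ᵥ w := by
  have hΓ := pm_le_range_toGL Γ
  have hd := isDiscreteSubgroup_pm Γ
  constructor
  · rintro ⟨γ, hγ, heq⟩
    have hγ' : γ ∈ pm Γ := le_pm Γ hγ
    obtain ⟨g, rfl⟩ := exists_toGL_eq_of_mem Γ hγ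
    -- `i = j`: otherwise the horoballs of the inequivalent cusps `γ 𝔞_i`, `𝔞_j` would meet
    have hij : i = j := by
      by_contra hij
      obtain ⟨hσ', hper'⟩ := scaling_smul (frameGL_smul_infty Γ i) (strictPeriods_frame Γ i) hγ'
      have hab : (Matrix.SpecialLinearGroup.toGL g : GL (Fin 2) ℝ) • cusp Γ i ≠ cusp Γ j :=
        fun h => hij (cusp_inequivalent_pm Γ hγ' h)
      have key := horoball_disjoint hΓ hd hσ' hper' (frameGL_smul_infty Γ j) (strictPeriods_frame Γ j) hab hw hw'
      exact key (by rw [map_mul, mul_smul]; exact heq)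
    subst hij
    refine ⟨rfl, ?_⟩
    -- `γ` fixes `𝔞_i`, so `σ_i⁻¹ γ σ_i = ± Tⁿ`
    have hfix := smul_cusp_eq_of_horoball_meet hΓ hd (frameGL_smul_infty Γ i) (strictPeriods_frame Γ i) hγ' le_rfl
      hw' hw heq
    obtain ⟨n, hn⟩ := conj_eq_upperRightHom_of_smul_eq hΓ (neg_one_mem_pm Γ) hd (frameGL_smul_infty Γ i)
      (strictPeriods_frame Γ i) hγ' hfix
    refine ⟨n, ?_⟩
    have e : ((frameGL Γ i)⁻¹ * Matrix.SpecialLinearGroup.toGL g * frameGL Γ i) • w = w' := by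
      rw [mul_smul, mul_smul, heq, inv_smul_smul]
    rcases hn with hn | hn
    · rw [← e, hn, upperRightHom_smul]
    · rw [← e, hn, UpperHalfPlane.neg_smul, upperRightHom_smul]
  · rintro ⟨rfl, n, rfl⟩
    obtain ⟨γ, hγ, e⟩ := exists_mem_smul_frame_eq_vadd Γ i n
    exact ⟨γ, hγ, e w⟩

/-- Points of one sector `σ_i{Im > 1}` in the same `Γ`-orbit differ by an integer translation in the frame.
[cite: ShimuraIATAF1971, §1.5 Thm. 1.28 (proof)] -/
theorem exists_eq_vadd_of_smul_frame_eq {i : Fin (numCusps Γ)} {w w' : ℍ} (hw : 1 < w.im) (hw' : 1 < w'.im)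
    {γ : GL (Fin 2) ℝ} (hγ : γ ∈ (Γ : Subgroup (GL (Fin 2) ℝ))) (heq : γ • frameGL Γ i • w = frameGL Γ i • w') :
    ∃ n : ℤ, w' = (n : ℝ) +ᵥ w :=
  ((exists_mem_smul_frame_smul_eq_iff Γ hw hw').mp ⟨γ, hγ, heq⟩).2

/-- Sectors of DISTINCT cusps of the system are `Γ`-disjoint. [cite: Iwaniec2002, §2.2 (2.4)] -/
theorem ne_of_smul_frame_eq {i j : Fin (numCusps Γ)} {w w' : ℍ} (hw : 1 < w.im) (hw' : 1 < w'.im)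
    {γ : GL (Fin 2) ℝ} (hγ : γ ∈ (Γ : Subgroup (GL (Fin 2) ℝ))) (heq : γ • frameGL Γ i • w = frameGL Γ j • w') : i = j :=
  ((exists_mem_smul_frame_smul_eq_iff Γ hw hw').mp ⟨γ, hγ, heq⟩).1

end Sector

end ModularCurve

end Literature.NumberTheory.ModularForms

end
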